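import Summits.AtomisticToContinuum.HydrodynamicLimit.Theorems.InformationPercolationEngineCollisionRate
import Summits.AtomisticToContinuum.HydrodynamicLimit.Theorems.InformationPercolationEngineCollisionRateTubeRegular
import Summits.AtomisticToContinuum.HydrodynamicLimit.Theorems.InformationPercolationEngineCollisionRateUnitMarkTruncationRung0
import Summits.AtomisticToContinuum.HydrodynamicLimit.Theorems.InformationPercolationEngineCollisionRateCylinderPullbackUnitRung0
import Summits.AtomisticToContinuum.HydrodynamicLimit.Theorems.InformationPercolationEngineCollisionRateMeanEnskogUnitRung0
import Summits.AtomisticToContinuum.HydrodynamicLimit.Theorems.InformationPercolationEngineCollisionRateFixedTimeVarianceUnitRung0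
import Summits.AtomisticToContinuum.HydrodynamicLimit.Theorems.InformationPercolationEngineCollisionRateRung0
import Summits.AtomisticToContinuum.HydrodynamicLimit.Theorems.JParityClosureEvenStressEnskogL2ToProbability
import Summits.AtomisticToContinuum.HydrodynamicLimit.Theorems.OneFlightGossipEngineCollisionActivityTailsAbnormalActivityStatics
import Literature.MathematicalPhysics.KineticTheory.EvenCollisionTubeFunctional
import Literature.Analysis.FluidPDE.HardSphereCollisionRecord
import Literature.MathematicalPhysics.KineticTheory.CollisionFluxMeanBoundNonStationary
import Literature.MathematicalPhysics.KineticTheory.CollisionFluxUpperBound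
import Literature.MathematicalPhysics.KineticTheory.ShortFlightCount
import Literature.MathematicalPhysics.KineticTheory.CollisionTubePullbackDefs
import HarnessLib

/-!
# Crux `InformationPercolationEngine.CollisionRate` (stmt-AtomisticToContinuum-13481), line `Sketch`:
# stub `stub_shortFlightDeficitLG_of_flux` (T2b′) — the short-flight deficit under the evolved local
# Gibbs law, from the two collision-flux bounds (F2), (F3)

For `N + 1` hard spheres of diameter `ε = hsDiameter σ N` on `𝕋³` under the EVOLVED local Gibbs law
`LG = localGibbsLaw σ a₀ u₀ θ₀ N (Φ N)` (continuous profiles), GIVEN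
* (F2) the pair collision-flux bound in Markov form: for sub-horizons `τ' ≤ τ` and measurable marks
  `b ≥ 0` of the two velocities, `LG{z good, Σ_{collisions in [0,τ']} b ≥ η} ≤ η⁻¹ C τ' (N+1)² ε² E[‖w−v‖ b]`
  (`E` over two independent reference Gaussians `N(u, θ)`), and
* (F3) the forward-contact flux bound: `LG{z good, Σ_{collisions (s,i,j), s ∈ [0,τ']} #{j' on a free
  collision course with i within time ℓ} ≥ η} ≤ η⁻¹ C τ' ℓ (N+1)³ ε⁴ E‖w−v‖²`,
the normalised SHORT-FLIGHT DEFICIT `((N+1)κ)⁻¹ · shortFlightDeficit σ N (Φ N) τ Ψ κ` of the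
collision-cylinder pull-back (`CollisionTubePullbackDefs`) with any mark `|Ψ| ≤ 2L` exceeds `η` with
`LG`-probability at most `δ`, for `κ < κ₀(σ, τ, L, η, δ, C's, u's, θ's)` and `N ≥ N₀`, `κ₀` NOT depending
on `N`.

Proof (pure bookkeeping port of `localGibbsLaw_shortFlightCount_ge_le` and `stub_shortFlightDeficitRung0`,
the three rung-0 flux-bound calls becoming instances of the hypotheses).  Pathwise on a good orbit
`R_short ≤ 2L · κε · #short(κε)` (`shortFlightDeficit_le_mul_count`) and
`#short(ℓ) ≤ K₁(ℓ) + K₃ + 2 K_F` (`shortFlightCount_le_chargedSums`, `ε < 1/2`): early collisions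
(window `[0, ℓ]`, mark `1`), fast re-collisions (window `[0, τ]`, mark `‖w − v‖/R`, `R = (1/2 − ε)/ℓ`,
`R⁻¹ ≤ 4ℓ`) — both instances of (F2) — and the collision sum of the forward-contact count (F3).  With
`y = η(N+1)/(2Lε)`, `ℓ = κε ≤ τ`, `(N+1)ε³ = σ³ ≤ 1` and the Gaussian moments
`E‖w − v‖, E‖w − v‖² ≤ 1 + 4(‖u‖² + 3θ)` (`lintegral_relSpeed_le`, `lintegral_relSpeed_sq_le`) the union
bound is `≤ A κ ≤ δ` for `κ < δ/(A + 1)`, `A = 2L(3C₂M₂ + 12τC₂M₂ + 6τC₃M₃)/η`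
(`shortFlightDeficitLG_constants_le`).

References: C. Cercignani, R. Illner, M. Pulvirenti, *The Mathematical Theory of Dilute Gases* (1994),
§2.2, App. 4.A; I. Gallagher, L. Saint-Raymond, B. Texier, *From Newton to Boltzmann* (2013), Prop. 4.1.1.
-/

open scoped BigOperators Topology Classical MeasureTheory ProbabilityTheory InnerProductSpace ENNReal
open Filter Set Function MeasureTheory
open Literature.Analysis.FluidPDE Literature.MathematicalPhysics.KineticTheory

namespace Summit.AtomisticToContinuum.HydrodynamicLimit.Theorems.CollisionRate

/-- **Arithmetic of the constants** in `stub_shortFlightDeficitLG_of_flux`: with `y = η n / (2 L e)`,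
`ℓ = κ e`, `n e³ ≤ 1`, `e ≤ 1` and `κ < δ / (A + 1)`, `A = 2L(3 C₂ M₂ + 12 τ C₂ M₂ + 6 τ C₃ M₃)/η`, the
three charged bounds `3y⁻¹ C₂ ℓ n² e² M₂ + 3y⁻¹ C₂ τ n² e² M₂ 4ℓ + 6y⁻¹ C₃ τ ℓ n³ e⁴ M₃` sum to at most
`A κ ≤ δ`. [folklore] -/
theorem shortFlightDeficitLG_constants_le {L C₂ C₃ M₂ M₃ τ η δ κ n e ℓ y A : ℝ} (hL : 0 < L)
    (hC₂ : 0 ≤ C₂) (hC₃ : 0 ≤ C₃) (hM₂ : 0 ≤ M₂) (hM₃ : 0 ≤ M₃) (hτ : 0 < τ) (hη : 0 < η) (hδ : 0 < δ)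
    (hκ : 0 < κ) (hn : 0 < n) (he : 0 < e) (he1 : e ≤ 1) (hne : n * e ^ 3 ≤ 1) (hℓ : κ * e = ℓ)
    (hy : y = η * n / (2 * L * e))
    (hA : A = 2 * L * (3 * C₂ * M₂ + 12 * τ * C₂ * M₂ + 6 * τ * C₃ * M₃) / η) (hκA : κ < δ / (A + 1)) :
    (y / 3)⁻¹ * (C₂ * ℓ * n ^ 2 * e ^ 2 * M₂) +
      (y / 3)⁻¹ * (C₂ * τ * n ^ 2 * e ^ 2 * (M₂ * (4 * ℓ))) +
      (y / 6)⁻¹ * (C₃ * τ * ℓ * n ^ 3 * e ^ 4 * M₃) ≤ δ := by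
  subst hℓ hy
  have hA0 : 0 ≤ A := by rw [hA]; positivity
  have hne4 : n * e ^ 4 ≤ 1 := by
    calc n * e ^ 4 = (n * e ^ 3) * e := by ring
      _ ≤ 1 * 1 := mul_le_mul hne he1 he.le zero_le_one
      _ = 1 := one_mul 1
  have hne6 : n ^ 2 * e ^ 6 ≤ 1 := by
    calc n ^ 2 * e ^ 6 = (n * e ^ 3) ^ 2 := by ring
      _ ≤ 1 := pow_le_one₀ (by positivity) hne
  have hAκ : A * κ ≤ δ := by
    have h1 : A * κ ≤ A * (δ / (A + 1)) := mul_le_mul_of_nonneg_left hκA.le hA0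
    have h2 : A * (δ / (A + 1)) ≤ δ := by
      rw [mul_div_assoc', div_le_iff₀ (by positivity), mul_add, mul_one, mul_comm δ A]
      exact le_add_of_nonneg_right hδ.le
    exact h1.trans h2
  have hX₁ : (η * n / (2 * L * e) / 3)⁻¹ * (C₂ * (κ * e) * n ^ 2 * e ^ 2 * M₂) =
      6 * L * C₂ * M₂ * κ / η * (n * e ^ 4) := by
    field_simp
    ring
  have hX₂ : (η * n / (2 * L * e) / 3)⁻¹ * (C₂ * τ * n ^ 2 * e ^ 2 * (M₂ * (4 * (κ * e)))) =
      24 * L * τ * C₂ * M₂ * κ / η * (n * e ^ 4) := by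
    field_simp
    ring
  have hX₃ : (η * n / (2 * L * e) / 6)⁻¹ * (C₃ * τ * (κ * e) * n ^ 3 * e ^ 4 * M₃) =
      12 * L * τ * C₃ * M₃ * κ / η * (n ^ 2 * e ^ 6) := by
    field_simp
    ring
  rw [hX₁, hX₂, hX₃]
  calc 6 * L * C₂ * M₂ * κ / η * (n * e ^ 4) + 24 * L * τ * C₂ * M₂ * κ / η * (n * e ^ 4) +
        12 * L * τ * C₃ * M₃ * κ / η * (n ^ 2 * e ^ 6)
      ≤ 6 * L * C₂ * M₂ * κ / η * 1 + 24 * L * τ * C₂ * M₂ * κ / η * 1 +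
        12 * L * τ * C₃ * M₃ * κ / η * 1 :=
        add_le_add (add_le_add (mul_le_mul_of_nonneg_left hne4 (by positivity))
          (mul_le_mul_of_nonneg_left hne4 (by positivity)))
          (mul_le_mul_of_nonneg_left hne6 (by positivity))
    _ = A * κ := by rw [hA]; ring
    _ ≤ δ := hAκ

/-- **T2b′ · the short-flight deficit under the evolved local Gibbs law, from the two flux bounds (F2), (F3)** (registered stub `stub_shortFlightDeficitLG_of_flux` of crux stmt-AtomisticToContinuum-13481, line `Sketch`, skeleton v21): port of `localGibbsLaw_shortFlightCount_ge_le` + `shortFlightDeficit_le_mul_count` + the rung-0 bookkeeping of `stub_shortFlightDeficitRung0`. [folklore] -/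
theorem stub_shortFlightDeficitLG_of_flux :
    (∀ (a₀ θ₀ : T3 → ℝ) (u₀ : T3 → V3), Continuous a₀ → Continuous θ₀ → Continuous u₀ →
      (∀ x, 0 < a₀ x) → (∀ x, 0 < θ₀ x) → ∃ σ₀ : ℝ, 0 < σ₀ ∧ ∀ σ : ℝ, 0 < σ → σ < σ₀ →
      ∀ Φ : (N : ℕ) → HardSphereFlow (Torus.geometry (Fin 3)) (hsDiameter σ N) (N + 1),
      ∀ τ : ℝ, 0 < τ → ∃ C : ℝ, 0 ≤ C ∧ ∃ u : V3, ∃ θ : ℝ, 0 < θ ∧ ∃ N₀ : ℕ, ∀ N : ℕ, N₀ ≤ N →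
      ∀ τ' : ℝ, 0 < τ' → τ' ≤ τ → ∀ b : V3 × V3 → ℝ, Measurable b → (∀ p, 0 ≤ b p) → ∀ η : ℝ, 0 < η →
        localGibbsLaw σ a₀ u₀ θ₀ N (Φ N)
            {z | z ∈ (Φ N).good ∧ η ≤ ∑ᶠ s ∈ collisionTimes (Torus.geometry (Fin 3)) (hsDiameter σ N)
                (fun t => (Φ N).flow t z) ∩ Set.Icc 0 τ',
              ∑ i : Fin (N + 1), ∑ j : Fin (N + 1),
                (if i ≠ j ∧ ‖(Torus.geometry (Fin 3)).sepVec ((Φ N).flow s z i).1 ((Φ N).flow s z j).1‖ =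
                    hsDiameter σ N then b (((Φ N).flow s z i).2, ((Φ N).flow s z j).2) else 0)} ≤
          (ENNReal.ofReal η)⁻¹ * (ENNReal.ofReal (C * τ' * ((N + 1 : ℕ) : ℝ) ^ 2 * hsDiameter σ N ^ 2) *
            ∫⁻ p, ENNReal.ofReal (‖p.2 - p.1‖ * b p) ∂((gaussMeasure u θ).prod (gaussMeasure u θ)))) →
    (∀ (a₀ θ₀ : T3 → ℝ) (u₀ : T3 → V3), Continuous a₀ → Continuous θ₀ → Continuous u₀ →
      (∀ x, 0 < a₀ x) → (∀ x, 0 < θ₀ x) → ∃ σ₀ : ℝ, 0 < σ₀ ∧ ∀ σ : ℝ, 0 < σ → σ < σ₀ →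
      ∀ Φ : (N : ℕ) → HardSphereFlow (Torus.geometry (Fin 3)) (hsDiameter σ N) (N + 1),
      ∀ τ : ℝ, 0 < τ → ∃ C : ℝ, 0 ≤ C ∧ ∃ u : V3, ∃ θ : ℝ, 0 < θ ∧ ∃ N₀ : ℕ, ∀ N : ℕ, N₀ ≤ N →
      ∀ τ' : ℝ, 0 < τ' → τ' ≤ τ → ∀ ℓ : ℝ, 0 < ℓ → ∀ η : ℝ, 0 < η →
        localGibbsLaw σ a₀ u₀ θ₀ N (Φ N)
            {z | z ∈ (Φ N).good ∧ η ≤ ∑ᶠ s ∈ collisionTimes (Torus.geometry (Fin 3)) (hsDiameter σ N)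
                (fun t => (Φ N).flow t z) ∩ Set.Icc 0 τ',
              ∑ i : Fin (N + 1), ∑ j : Fin (N + 1),
                (if i ≠ j ∧ ‖(Torus.geometry (Fin 3)).sepVec ((Φ N).flow s z i).1 ((Φ N).flow s z j).1‖ = hsDiameter σ N
                  then (∑ j' : Fin (N + 1), if j' ≠ i ∧ j' ≠ j ∧ ∃ t ∈ Set.Ioo 0 ℓ,
                    ‖Torus.reprSym ((((Φ N).flow s z j').1 - ((Φ N).flow s z i).1) +
                      Literature.Analysis.FunctionSpaces.Torus.proj (t • (((Φ N).flow s z j').2 - ((Φ N).flow s z i).2)))‖ = hsDiameter σ N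
                    then (1 : ℝ) else 0) else 0)} ≤
          (ENNReal.ofReal η)⁻¹ * (ENNReal.ofReal (C * τ' * ℓ * ((N + 1 : ℕ) : ℝ) ^ 3 * hsDiameter σ N ^ 4) *
            ∫⁻ q, ENNReal.ofReal (‖q.2 - q.1‖ ^ 2) ∂((gaussMeasure u θ).prod (gaussMeasure u θ)))) →
    ∀ (a₀ θ₀ : T3 → ℝ) (u₀ : T3 → V3), Continuous a₀ → Continuous θ₀ → Continuous u₀ →
      (∀ x, 0 < a₀ x) → (∀ x, 0 < θ₀ x) → ∃ σ₀ : ℝ, 0 < σ₀ ∧ ∀ σ : ℝ, 0 < σ → σ < σ₀ →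
      ∀ Φ : (N : ℕ) → HardSphereFlow (Torus.geometry (Fin 3)) (hsDiameter σ N) (N + 1),
      ∀ τ : ℝ, 0 < τ → ∀ η δ : ℝ, 0 < η → 0 < δ →
      ∀ L : ℝ, 1 ≤ L → ∃ κ₀ : ℝ, 0 < κ₀ ∧ ∀ κ : ℝ, 0 < κ → κ < κ₀ → ∃ N₀ : ℕ, ∀ N : ℕ, N₀ ≤ N →
      ∀ Ψ : V3 × V3 × V3 → ℝ, (∀ q, |Ψ q| ≤ 2 * L) →
        localGibbsLaw σ a₀ u₀ θ₀ N (Φ N)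
          {z | η < ((N + 1 : ℝ) * κ)⁻¹ * shortFlightDeficit σ N (Φ N) τ Ψ κ z} ≤ ENNReal.ofReal δ := by
  intro hF2 hF3 a₀ θ₀ u₀ hac hθc huc ha0 hθ0
  obtain ⟨σ₂, hσ₂, h2⟩ := hF2 a₀ θ₀ u₀ hac hθc huc ha0 hθ0
  obtain ⟨σ₃, hσ₃, h3⟩ := hF3 a₀ θ₀ u₀ hac hθc huc ha0 hθ0
  refine ⟨min (min σ₂ σ₃) (1 / 4), lt_min (lt_min hσ₂ hσ₃) (by norm_num),
    fun σ hσ hσlt Φ τ hτ η δ hη hδ L hL => ?_⟩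
  have hσ₂' : σ < σ₂ := hσlt.trans_le ((min_le_left _ _).trans (min_le_left _ _))
  have hσ₃' : σ < σ₃ := hσlt.trans_le ((min_le_left _ _).trans (min_le_right _ _))
  have hσ4 : σ ≤ 1 / 4 := (hσlt.trans_le (min_le_right _ _)).le
  have hσ1 : σ ≤ 1 := by linarith
  obtain ⟨C₂, hC₂, u₂, θ₂, hθ₂, N₂, hb2⟩ := h2 σ hσ hσ₂' Φ τ hτ
  obtain ⟨C₃, hC₃, u₃, θ₃, hθ₃, N₃, hb3⟩ := h3 σ hσ hσ₃' Φ τ hτ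
  have hL0 : 0 < L := by linarith
  -- Gaussian moments of the two reference Gaussians: `E‖w - v‖, E‖w - v‖² ≤ 1 + 4 (‖u‖² + 3 θ)`
  set M₂ : ℝ := 1 + 4 * (‖u₂‖ ^ 2 + 3 * θ₂) with hM₂
  set M₃ : ℝ := 1 + 4 * (‖u₃‖ ^ 2 + 3 * θ₃) with hM₃
  have hM₂0 : 0 < M₂ := by positivity
  have hM₃0 : 0 < M₃ := by positivity
  have hm₁ : ∫⁻ q, ENNReal.ofReal ‖q.2 - q.1‖ ∂((gaussMeasure u₂ θ₂).prod (gaussMeasure u₂ θ₂)) ≤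
      ENNReal.ofReal M₂ := EvenStressEnskog.lintegral_relSpeed_le u₂ hθ₂
  have hm₂ : ∫⁻ q, ENNReal.ofReal (‖q.2 - q.1‖ ^ 2) ∂((gaussMeasure u₂ θ₂).prod (gaussMeasure u₂ θ₂)) ≤
      ENNReal.ofReal M₂ :=
    (EvenStressEnskog.lintegral_relSpeed_sq_le u₂ hθ₂).trans (ENNReal.ofReal_le_ofReal (by linarith))
  have hm₃ : ∫⁻ q, ENNReal.ofReal (‖q.2 - q.1‖ ^ 2) ∂((gaussMeasure u₃ θ₃).prod (gaussMeasure u₃ θ₃)) ≤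
      ENNReal.ofReal M₃ :=
    (EvenStressEnskog.lintegral_relSpeed_sq_le u₃ hθ₃).trans (ENNReal.ofReal_le_ofReal (by linarith))
  -- the constant governing `κ₀` (it does not depend on `N`)
  set A : ℝ := 2 * L * (3 * C₂ * M₂ + 12 * τ * C₂ * M₂ + 6 * τ * C₃ * M₃) / η with hA
  have hA0 : 0 ≤ A := by positivity
  refine ⟨min τ (δ / (A + 1)), lt_min hτ (by positivity), fun κ hκ hκlt =>
    ⟨max N₂ N₃, fun N hN Ψ hΨ => ?_⟩⟩
  have hκτ : κ < τ := hκlt.trans_le (min_le_left _ _)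
  have hκA : κ < δ / (A + 1) := hκlt.trans_le (min_le_right _ _)
  have hN₂ : N₂ ≤ N := (le_max_left _ _).trans hN
  have hN₃ : N₃ ≤ N := (le_max_right _ _).trans hN
  have hε : 0 < hsDiameter σ N := hsDiameter_pos hσ N
  have hε4 : hsDiameter σ N ≤ 1 / 4 := (hsDiameter_le hσ.le N).trans hσ4
  have hε1 : hsDiameter σ N ≤ 1 := by linarith
  have hε2 : hsDiameter σ N < 1 / 2 := by linarith
  have hn : (0 : ℝ) < (N + 1 : ℝ) := by positivity
  have hcast : ((N + 1 : ℕ) : ℝ) = (N + 1 : ℝ) := Nat.cast_succ N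
  have hℓ' : 0 < κ * hsDiameter σ N := mul_pos hκ hε
  -- the window length `ℓ = κ ε ≤ τ`
  obtain ⟨ℓ, hκε, hℓ, hℓτ⟩ : ∃ ℓ : ℝ, κ * hsDiameter σ N = ℓ ∧ 0 < ℓ ∧ ℓ ≤ τ :=
    ⟨_, rfl, hℓ', (mul_le_mul_of_nonneg_left hε1 hκ.le).trans (by rw [mul_one]; exact hκτ.le)⟩
  have hR : 0 < (1 / 2 - hsDiameter σ N) / ℓ := div_pos (by linarith) hℓ
  have hRinv : ((1 / 2 - hsDiameter σ N) / ℓ)⁻¹ ≤ 4 * ℓ := by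
    rw [inv_div, div_le_iff₀ (by linarith)]
    nlinarith
  set P := localGibbsLaw σ a₀ u₀ θ₀ N (Φ N)
  set y : ℝ := η * (N + 1 : ℝ) / (2 * L * hsDiameter σ N) with hy
  have hy0 : 0 < y := by positivity
  -- the short-flight-count event and the three charged events
  set B : Set (Config (N + 1) (Fin 3) T3) := {z | z ∈ (Φ N).good ∧ y ≤
      collisionPairSum (Torus.geometry (Fin 3)) (hsDiameter σ N) (orbit σ N (Φ N) z) (Icc 0 τ)
        (fun s i j => if s - ℓ < pairFlightStart σ N (Φ N) z i j s then (1 : ℝ) else 0)}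
  set B₁ : Set (Config (N + 1) (Fin 3) T3) := {z | z ∈ (Φ N).good ∧ y / 3 ≤
      ∑ᶠ s ∈ collisionTimes (Torus.geometry (Fin 3)) (hsDiameter σ N) (fun t => (Φ N).flow t z) ∩ Icc 0 ℓ,
        ∑ i : Fin (N + 1), ∑ j : Fin (N + 1),
          (if i ≠ j ∧ ‖(Torus.geometry (Fin 3)).sepVec ((Φ N).flow s z i).1 ((Φ N).flow s z j).1‖ =
              hsDiameter σ N
            then (fun _ : V3 × V3 => (1 : ℝ)) (((Φ N).flow s z i).2, ((Φ N).flow s z j).2) else 0)}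
    with hB₁def
  set B₂ : Set (Config (N + 1) (Fin 3) T3) := {z | z ∈ (Φ N).good ∧ y / 3 ≤
      ∑ᶠ s ∈ collisionTimes (Torus.geometry (Fin 3)) (hsDiameter σ N) (fun t => (Φ N).flow t z) ∩ Icc 0 τ,
        ∑ i : Fin (N + 1), ∑ j : Fin (N + 1),
          (if i ≠ j ∧ ‖(Torus.geometry (Fin 3)).sepVec ((Φ N).flow s z i).1 ((Φ N).flow s z j).1‖ =
              hsDiameter σ N
            then (fun q : V3 × V3 => ‖q.2 - q.1‖ / ((1 / 2 - hsDiameter σ N) / ℓ))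
              (((Φ N).flow s z i).2, ((Φ N).flow s z j).2) else 0)} with hB₂def
  set B₃ : Set (Config (N + 1) (Fin 3) T3) := {z | z ∈ (Φ N).good ∧ y / 6 ≤
      ∑ᶠ s ∈ collisionTimes (Torus.geometry (Fin 3)) (hsDiameter σ N) (fun t => (Φ N).flow t z) ∩ Icc 0 τ,
        ∑ i : Fin (N + 1), ∑ j : Fin (N + 1),
          (if i ≠ j ∧ ‖(Torus.geometry (Fin 3)).sepVec ((Φ N).flow s z i).1 ((Φ N).flow s z j).1‖ =
              hsDiameter σ N
            then (∑ j' : Fin (N + 1), if j' ≠ i ∧ j' ≠ j ∧ ∃ t ∈ Ioo 0 ℓ,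
              ‖Torus.reprSym ((((Φ N).flow s z j').1 - ((Φ N).flow s z i).1) +
                Literature.Analysis.FunctionSpaces.Torus.proj
                  (t • (((Φ N).flow s z j').2 - ((Φ N).flow s z i).2)))‖ = hsDiameter σ N
              then (1 : ℝ) else 0) else 0)} with hB₃def
  -- pathwise: a large normalised deficit forces a large short-flight count (`R_short ≤ 2L ℓ · #short`)
  have hsub₀ : {z | η < ((N + 1 : ℝ) * κ)⁻¹ * shortFlightDeficit σ N (Φ N) τ Ψ κ z} ⊆ (Φ N).goodᶜ ∪ B := by
    intro z hz
    by_cases hgood : z ∈ (Φ N).good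
    · refine Or.inr ⟨hgood, ?_⟩
      have h1 := shortFlightDeficit_le_mul_count hgood hΨ τ hℓ'
      rw [hκε] at h1
      have h2 : η < ((N + 1 : ℝ) * κ)⁻¹ * shortFlightDeficit σ N (Φ N) τ Ψ κ z := hz
      by_contra hlt
      have hlt' := not_le.1 hlt
      have h3 : shortFlightDeficit σ N (Φ N) τ Ψ κ z < 2 * L * ℓ * y :=
        h1.trans_lt (mul_lt_mul_of_pos_left hlt' (by positivity))
      have h4 : 2 * L * ℓ * y = η * ((N + 1 : ℝ) * κ) := by
        rw [hy, ← hκε, mul_div_assoc', div_eq_iff (by positivity)]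
        ring
      rw [h4] at h3
      have h5 : ((N + 1 : ℝ) * κ)⁻¹ * shortFlightDeficit σ N (Φ N) τ Ψ κ z < η := by
        rw [inv_mul_lt_iff₀ (by positivity)]
        linarith
      linarith
    · exact Or.inl hgood
  -- pathwise charging: a large short-flight count makes one of the three charged sums large
  have hsub : B ⊆ B₁ ∪ B₂ ∪ B₃ := by
    rintro z ⟨hz, hle⟩
    by_cases hz1 : z ∈ B₁
    · exact Or.inl (Or.inl hz1)
    by_cases hz2 : z ∈ B₂
    · exact Or.inl (Or.inr hz2)
    by_cases hz3 : z ∈ B₃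
    · exact Or.inr hz3
    exfalso
    have h := hle.trans (shortFlightCount_le_chargedSums hz hε2 τ hℓ)
    rw [collisionPairSum_eq_finsum_ite (orbit_mem hz), collisionPairSum_eq_finsum_ite (orbit_mem hz),
      collisionPairSum_eq_finsum_ite (orbit_mem hz)] at h
    delta orbit at h
    beta_reduce at h
    simp only [hB₁def, hB₂def, hB₃def, mem_setOf_eq, not_and, not_le] at hz1 hz2 hz3
    have h1 := hz1 hz
    have h2 := hz2 hz
    have h3 := hz3 hz
    linarith
  -- (F2), window `[0, ℓ]`, mark `1`: the early collisions
  have hb₁ : P B₁ ≤ ENNReal.ofReal ((y / 3)⁻¹ * (C₂ * ℓ * (N + 1 : ℝ) ^ 2 * hsDiameter σ N ^ 2 * M₂)) := by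
    have h : P B₁ ≤ _ := hb2 N hN₂ ℓ hℓ hℓτ (fun _ : V3 × V3 => (1 : ℝ)) measurable_const
      (fun _ => zero_le_one) (y / 3) (by positivity)
    have hI : ∫⁻ p, ENNReal.ofReal (‖p.2 - p.1‖ * 1) ∂((gaussMeasure u₂ θ₂).prod (gaussMeasure u₂ θ₂)) ≤
        ENNReal.ofReal M₂ := by
      simpa only [mul_one] using hm₁
    refine h.trans ((mul_le_mul_right (mul_le_mul_right hI _) _).trans_eq ?_)
    rw [hcast, ← ENNReal.ofReal_mul (by positivity), ← ENNReal.ofReal_inv_of_pos (by positivity),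
      ← ENNReal.ofReal_mul (by positivity)]
  -- (F2), window `[0, τ]`, mark `‖w - v‖ / R`, `R = (1/2 - ε)/ℓ`, `R⁻¹ ≤ 4 ℓ`: the fast re-collisions
  have hb₂ : P B₂ ≤ ENNReal.ofReal ((y / 3)⁻¹ *
      (C₂ * τ * (N + 1 : ℝ) ^ 2 * hsDiameter σ N ^ 2 * (M₂ * (4 * ℓ)))) := by
    have h : P B₂ ≤ _ := hb2 N hN₂ τ hτ le_rfl
      (fun q : V3 × V3 => ‖q.2 - q.1‖ / ((1 / 2 - hsDiameter σ N) / ℓ)) (by fun_prop)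
      (fun q => div_nonneg (norm_nonneg _) hR.le) (y / 3) (by positivity)
    have hI : ∫⁻ p, ENNReal.ofReal (‖p.2 - p.1‖ * (‖p.2 - p.1‖ / ((1 / 2 - hsDiameter σ N) / ℓ)))
        ∂((gaussMeasure u₂ θ₂).prod (gaussMeasure u₂ θ₂)) ≤
        ENNReal.ofReal M₂ * ENNReal.ofReal ((1 / 2 - hsDiameter σ N) / ℓ)⁻¹ := by
      calc ∫⁻ p, ENNReal.ofReal (‖p.2 - p.1‖ * (‖p.2 - p.1‖ / ((1 / 2 - hsDiameter σ N) / ℓ)))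
            ∂((gaussMeasure u₂ θ₂).prod (gaussMeasure u₂ θ₂))
          = ∫⁻ p, ENNReal.ofReal (‖p.2 - p.1‖ ^ 2) * ENNReal.ofReal ((1 / 2 - hsDiameter σ N) / ℓ)⁻¹
            ∂((gaussMeasure u₂ θ₂).prod (gaussMeasure u₂ θ₂)) := by
            refine lintegral_congr fun p => ?_
            rw [← ENNReal.ofReal_mul (by positivity)]
            congr 1
            rw [div_eq_mul_inv, sq, mul_assoc]
        _ = (∫⁻ p, ENNReal.ofReal (‖p.2 - p.1‖ ^ 2) ∂((gaussMeasure u₂ θ₂).prod (gaussMeasure u₂ θ₂))) *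
            ENNReal.ofReal ((1 / 2 - hsDiameter σ N) / ℓ)⁻¹ :=
            lintegral_mul_const' _ _ ENNReal.ofReal_ne_top
        _ ≤ ENNReal.ofReal M₂ * ENNReal.ofReal ((1 / 2 - hsDiameter σ N) / ℓ)⁻¹ :=
            mul_le_mul_left hm₂ _
    refine h.trans ((mul_le_mul_right (mul_le_mul_right (hI.trans
      (mul_le_mul_right (ENNReal.ofReal_le_ofReal hRinv) _)) _) _).trans_eq ?_)
    rw [hcast, ← ENNReal.ofReal_mul hM₂0.le, ← ENNReal.ofReal_mul (by positivity),
      ← ENNReal.ofReal_inv_of_pos (by positivity), ← ENNReal.ofReal_mul (by positivity)]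
  -- (F3), window `[0, τ]`, forward-contact count of length `ℓ`: the interrupted free flights
  have hb₃ : P B₃ ≤ ENNReal.ofReal ((y / 6)⁻¹ *
      (C₃ * τ * ℓ * (N + 1 : ℝ) ^ 3 * hsDiameter σ N ^ 4 * M₃)) := by
    have h : P B₃ ≤ _ := hb3 N hN₃ τ hτ le_rfl ℓ hℓ (y / 6) (by positivity)
    refine h.trans ((mul_le_mul_right (mul_le_mul_right hm₃ _) _).trans_eq ?_)
    rw [hcast, ← ENNReal.ofReal_mul (by positivity), ← ENNReal.ofReal_inv_of_pos (by positivity),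
      ← ENNReal.ofReal_mul (by positivity)]
  -- arithmetic of the constants: `y = η (N+1)/(2Lε)`, `ℓ = κ ε`, `(N+1) ε³ = σ³ ≤ 1`
  have hε3 : (N + 1 : ℝ) * hsDiameter σ N ^ 3 ≤ 1 := by
    have h : (N + 1 : ℝ) * hsDiameter σ N ^ 3 = σ ^ 3 := by
      exact_mod_cast succ_mul_hsDiameter_pow_three σ N
    rw [h]
    exact pow_le_one₀ hσ.le hσ1
  have hsum := shortFlightDeficitLG_constants_le hL0 hC₂ hC₃ hM₂0.le hM₃0.le hτ hη hδ hκ hn hε hε1 hε3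
    hκε hy hA hκA
  have hX₁0 : 0 ≤ (y / 3)⁻¹ * (C₂ * ℓ * (N + 1 : ℝ) ^ 2 * hsDiameter σ N ^ 2 * M₂) := by positivity
  have hX₂0 : 0 ≤ (y / 3)⁻¹ * (C₂ * τ * (N + 1 : ℝ) ^ 2 * hsDiameter σ N ^ 2 * (M₂ * (4 * ℓ))) := by
    positivity
  have hX₃0 : 0 ≤ (y / 6)⁻¹ * (C₃ * τ * ℓ * (N + 1 : ℝ) ^ 3 * hsDiameter σ N ^ 4 * M₃) := by positivity
  have hgood0 : P (Φ N).goodᶜ = 0 := localGibbsLaw_compl_good_eq_zero (Φ N)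
  -- union bound
  calc P {z | η < ((N + 1 : ℝ) * κ)⁻¹ * shortFlightDeficit σ N (Φ N) τ Ψ κ z}
      ≤ P ((Φ N).goodᶜ ∪ B) := measure_mono hsub₀
    _ ≤ P (Φ N).goodᶜ + P B := measure_union_le _ _
    _ ≤ 0 + P (B₁ ∪ B₂ ∪ B₃) := add_le_add hgood0.le (measure_mono hsub)
    _ ≤ P B₁ + P B₂ + P B₃ := by
        rw [zero_add]
        exact (measure_union_le _ _).trans (add_le_add (measure_union_le _ _) le_rfl)
    _ ≤ _ := add_le_add (add_le_add hb₁ hb₂) hb₃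
    _ = ENNReal.ofReal ((y / 3)⁻¹ * (C₂ * ℓ * (N + 1 : ℝ) ^ 2 * hsDiameter σ N ^ 2 * M₂) +
          (y / 3)⁻¹ * (C₂ * τ * (N + 1 : ℝ) ^ 2 * hsDiameter σ N ^ 2 * (M₂ * (4 * ℓ))) +
          (y / 6)⁻¹ * (C₃ * τ * ℓ * (N + 1 : ℝ) ^ 3 * hsDiameter σ N ^ 4 * M₃)) := by
        rw [ENNReal.ofReal_add (add_nonneg hX₁0 hX₂0) hX₃0, ENNReal.ofReal_add hX₁0 hX₂0]
    _ ≤ ENNReal.ofReal δ := ENNReal.ofReal_le_ofReal hsum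

end Summit.AtomisticToContinuum.HydrodynamicLimit.Theorems.CollisionRate
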